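import Summits.QuantumFields.YangMills.Theorems.AlphaInputsT3ACv3InnerLiftFine
import Literature.MathematicalPhysics.QuantumFieldTheory.Balaban1983to89.BlockAveragingSectionAction
import Literature.MathematicalPhysics.QuantumFieldTheory.Balaban1983to89.T3DescentFibreTower
import HarnessLib

/-!
# `AlphaInputsT3ACv3RegionSection` — STRATEGY B for 2′, the (FL) row read against print: **[Balaban1985Variational] (11) ON THE FREE-BOUNDARY REGION `Ω_k(h)`** —
# the tree's ITERATED FACE SECTION `iterSec k W` (all curvature on the edge plaquettes of the block decomposition) is an EXACT `k`-fold (0.4)-lift of ANY datum `W`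
# (`top42Set`), and its finest plaquettes with four corners under `Ω_k(h)` are EITHER trivial OR plaquettes of `W` inside `Ω_k(h)` — so a charged datum's window
# `ε_W(k)` bounds them (NO `L^{−2k}` gain: this is print's `V₀`, not the regular lift) — lane `pub-balaban3d` ∕ cell `ym3-torus`, seat `ym-ust-19936-w1` (g0)

WHY (this seat's PROGRESS 5, 2026-08-28: located reading of [Balaban1985Variational] pp.278–280).  Print does NOT construct the regular exact lift of Thm 1 (8) kinematically: at height
`k` it takes the trivial section (11) «V₀,b = V_b′ for b ∈ B(b′), b′ ∈ Λ_k, V₀,b = 1 for remaining bonds of B(Λ_k)» one level up (exact averages, plaquettes those of `V` or `1`), applies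
THEOREM 1 AT HEIGHT `k − 1` to `V₀` (12), and reads the resulting minimiser in the height-`k` spaces with `C₁ = L³` (13)–(14).  The tree has the section on the full torus
(`BlockAveragingSection.faceSec`, `BlockAveragingSectionAction.iterSec`, `iter_iterSec`, `plaqSmall_iterSec`; run-to-run `T3SectASteps.secTo`∕`stepA11`); the (FL) row of
`…v3InnerLiftFine` lives on the REGION `Ω_k(h)` with free boundary, where only the plaquettes INSIDE `Ω_k(h)` are windowed (`ChargedT3`).  THIS FILE: §1 the generic regional
dichotomy `plaqHol_iterSec_eq_one_or` for a nested family of site sets `R s` (`z ∈ R s ↔ blockOf z ∈ R (s+1)`): a finest plaquette cornered in `R 0` has `(iterSec k W)(∂q) = 1` or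
`= W(∂Q)` for a level-`k` plaquette `Q` cornered in `R k` (induction on `k` through `plaqHol_faceSec`: an edge plaquette reproduces the coarse plaquette over it, whose corners are the
blocks of its corners); `dist1_plaqHol_iterSec_le`; §2 at `Ω_k(h)` (nested by `mem_under_Omega_iff_blockOf`): ★ `AlphaInputsT3AC.iterSec_mem_top42Set` (exact `k`-fold `blockAvg ℰp`
averages on EVERY coarse bond, a fortiori (42) on `bondsIn k Ω_k(h)`), ★ `AlphaInputsT3AC.dist1_iterSec_le_region`, ★★ `AlphaInputsT3AC.section_of_chargedT3`: for a CHARGED datum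
the section is in `top42Set k h W` with finest plaquettes under `Ω_k(h)` `< ε_W(k) = 2L²·avgWindowFactor·θ(K−k+1)` — print's (11) for the region; the input «V₀» of a print-faithful
supplier «(FL)_k ⇐ Thm 1 (8) at height k−1 on Ω_k(h) + (11)» (the regional Thm 1 row is NOT in the tree; nothing of it is asserted here).
HONEST FRAMING.  Kinematics; (FL) (fine plaquettes `B·ε_W·L^{−2k}`) is NOT proved — the section has NO `L^{−2k}` gain; count-neutral helper toward R3 2′ (items 19936∕19935);
registry untouched; nothing about d = 4, the continuum, or a mass gap; YM₃ on T³ is rung R3, not Clay.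

References: T. Bałaban, Commun. Math. Phys. 102 (1985) 277–309 [Balaban1985Variational] ((11)–(14) pp.279–280); CMP 109 (1987) 249–301 [Balaban1987RG1] ((0.4), (0.11) p.253);
CMP 102 (1985) 255–275 [Balaban1985UV3] ((40)–(42) p.266).
-/

set_option autoImplicit false

noncomputable section

namespace Summit.QuantumFields.YangMills.Theorems

open Set
open scoped Matrix.Norms.L2Operator
open Literature.MathematicalPhysics.QuantumFieldTheory.Balaban1983to89
open Literature.MathematicalPhysics.QuantumFieldTheory.Balaban1983to89.T3ContinuumYM3Torus
open Literature.MathematicalPhysics.QuantumFieldTheory.Balaban1983to89.T3UnitLawDensityEML (ℰp)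
open Literature.MathematicalPhysics.QuantumFieldTheory.Balaban1983to89.T3UnitScaleTilt (θBal)
open Literature.MathematicalPhysics.QuantumFieldTheory.Balaban1983to89.T3DescentFibreTower (expMeanLogSU_E_one)
open Literature.MathematicalPhysics.QuantumFieldTheory.Balaban1983to89.B10Eq38TorusDomains (plaqsIn mem_plaqsIn_iff toFine)
open Literature.MathematicalPhysics.QuantumFieldTheory.Balaban1983to89.B10Eq42TorusConstraint (bondsIn)
open Literature.MathematicalPhysics.QuantumFieldTheory.Balaban1983to89.BlockAveragingSection (faceSec)
open Literature.MathematicalPhysics.QuantumFieldTheory.Balaban1983to89.BlockAveragingSectionPlaq (offset offset_shift_ne blockOf_shift plaqHol_faceSec)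
open Literature.MathematicalPhysics.QuantumFieldTheory.Balaban1983to89.BlockAveragingSectionAction (iterSec iter_iterSec)
open Literature.MathematicalPhysics.QuantumFieldTheory.Balaban1985CMP102.Setting
open Summit.QuantumFields.Balaban3D.Carriers
open Summit.QuantumFields.Balaban3D.Proofs.Primitives (AlphaConsts)

/-! ## §1 The regional plaquette dichotomy of the iterated face section -/

section Generic

variable {P : Params} {G : Type*} [GaugeGroup G]

/-- The corners of the coarse plaquette over an EDGE plaquette are the blocks of its corners. [cite: Balaban1987RG1, (0.1) p.251 (bookkeeping)] -/
theorem RegionSection.blockOf_corners_of_edge {j : ℕ} (hj : j + 1 ≤ P.m + P.K) (p : Plaq P j)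
    (hμ : offset p.src p.μ = P.L - 1) (hν : offset p.src p.ν = P.L - 1) :
    blockOf (p.src.shift p.μ) = (blockOf p.src).shift p.μ ∧ blockOf (p.src.shift p.ν) = (blockOf p.src).shift p.ν ∧
      blockOf ((p.src.shift p.μ).shift p.ν) = ((blockOf p.src).shift p.μ).shift p.ν := by
  have hne : p.ν ≠ p.μ := (ne_of_lt p.hμν).symm
  have h1 : blockOf (p.src.shift p.μ) = (blockOf p.src).shift p.μ := by rw [blockOf_shift hj p.src p.μ, if_pos hμ]
  have h2 : blockOf (p.src.shift p.ν) = (blockOf p.src).shift p.ν := by rw [blockOf_shift hj p.src p.ν, if_pos hν]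
  refine ⟨h1, h2, ?_⟩
  have hν' : offset (p.src.shift p.μ) p.ν = P.L - 1 := by rw [offset_shift_ne p.src hne]; exact hν
  rw [blockOf_shift hj (p.src.shift p.μ) p.ν, if_pos hν', h1]

/-- **THE REGIONAL PLAQUETTE DICHOTOMY OF THE ITERATED SECTION**: for a nested family of site sets `R s` (`z ∈ R s ↔ blockOf z ∈ R (s+1)` for `s < k`), every finest plaquette with
four corners in `R 0` has `(iterSec k W)(∂q) = 1` or `(iterSec k W)(∂q) = W(∂Q)` for some level-`k` plaquette `Q` with four corners in `R k`. [cite: Balaban1985Variational, (11) p.279] -/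
theorem RegionSection.plaqHol_iterSec_eq_one_or : ∀ (k : ℕ), k ≤ P.m + P.K → ∀ (R : (s : ℕ) → Set (Site P s)),
    (∀ s, s < k → ∀ z : Site P s, z ∈ R s ↔ blockOf z ∈ R (s + 1)) → ∀ (W : GaugeField P k G) (q : Plaq P 0),
    q.src ∈ R 0 → q.src.shift q.μ ∈ R 0 → q.src.shift q.ν ∈ R 0 → (q.src.shift q.μ).shift q.ν ∈ R 0 →
    GaugeField.plaqHol (iterSec k W) q = 1 ∨
      ∃ Q : Plaq P k, Q.src ∈ R k ∧ Q.src.shift Q.μ ∈ R k ∧ Q.src.shift Q.ν ∈ R k ∧ (Q.src.shift Q.μ).shift Q.ν ∈ R k ∧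
        GaugeField.plaqHol (iterSec k W) q = GaugeField.plaqHol W Q
  | 0, _, R, _, W, q, h1, h2, h3, h4 => Or.inr ⟨q, h1, h2, h3, h4, rfl⟩
  | k + 1, hk, R, hR, W, q, h1, h2, h3, h4 => by
    have hk' : k ≤ P.m + P.K := (Nat.le_succ k).trans hk
    have ih := RegionSection.plaqHol_iterSec_eq_one_or k hk' R (fun s hs => hR s (Nat.lt_succ_of_lt hs)) (faceSec W) q h1 h2 h3 h4
    change GaugeField.plaqHol (iterSec k (faceSec W)) q = 1 ∨
      ∃ Q : Plaq P (k + 1), Q.src ∈ R (k + 1) ∧ Q.src.shift Q.μ ∈ R (k + 1) ∧ Q.src.shift Q.ν ∈ R (k + 1) ∧ (Q.src.shift Q.μ).shift Q.ν ∈ R (k + 1) ∧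
        GaugeField.plaqHol (iterSec k (faceSec W)) q = GaugeField.plaqHol W Q
    rcases ih with h | ⟨Q', hQ1, hQ2, hQ3, hQ4, hval⟩
    · exact Or.inl h
    · rw [hval, plaqHol_faceSec hk W Q']
      by_cases hedge : offset Q'.src Q'.μ = P.L - 1 ∧ offset Q'.src Q'.ν = P.L - 1
      · rw [if_pos hedge]
        obtain ⟨e1, e2, e3⟩ := RegionSection.blockOf_corners_of_edge hk Q' hedge.1 hedge.2
        refine Or.inr ⟨⟨blockOf Q'.src, Q'.μ, Q'.ν, Q'.hμν⟩, (hR k (Nat.lt_succ_self k) _).1 hQ1, ?_, ?_, ?_, rfl⟩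
        · show (blockOf Q'.src).shift Q'.μ ∈ R (k + 1)
          rw [← e1]; exact (hR k (Nat.lt_succ_self k) _).1 hQ2
        · show (blockOf Q'.src).shift Q'.ν ∈ R (k + 1)
          rw [← e2]; exact (hR k (Nat.lt_succ_self k) _).1 hQ3
        · show ((blockOf Q'.src).shift Q'.μ).shift Q'.ν ∈ R (k + 1)
          rw [← e3]; exact (hR k (Nat.lt_succ_self k) _).1 hQ4
      · rw [if_neg hedge]
        exact Or.inl rfl

/-- Hence a bound on the plaquettes of `W` cornered in `R k` bounds the finest plaquettes of the section cornered in `R 0` (`0 ≤ ε`). [cite: Balaban1985Variational, (11) p.279] -/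
theorem RegionSection.dist1_plaqHol_iterSec_le (k : ℕ) (hk : k ≤ P.m + P.K) (R : (s : ℕ) → Set (Site P s))
    (hR : ∀ s, s < k → ∀ z : Site P s, z ∈ R s ↔ blockOf z ∈ R (s + 1)) (W : GaugeField P k G) {ε : ℝ} (hε : 0 ≤ ε)
    (hW : ∀ Q : Plaq P k, Q.src ∈ R k → Q.src.shift Q.μ ∈ R k → Q.src.shift Q.ν ∈ R k → (Q.src.shift Q.μ).shift Q.ν ∈ R k →
      GaugeGroup.dist1 (GaugeField.plaqHol W Q) ≤ ε)
    (q : Plaq P 0) (h1 : q.src ∈ R 0) (h2 : q.src.shift q.μ ∈ R 0) (h3 : q.src.shift q.ν ∈ R 0) (h4 : (q.src.shift q.μ).shift q.ν ∈ R 0) :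
    GaugeGroup.dist1 (GaugeField.plaqHol (iterSec k W) q) ≤ ε := by
  rcases RegionSection.plaqHol_iterSec_eq_one_or k hk R hR W q h1 h2 h3 h4 with h | ⟨Q, hQ1, hQ2, hQ3, hQ4, hval⟩
  · rw [h, GaugeGroup.dist1_one]; exact hε
  · rw [hval]; exact hW Q hQ1 hQ2 hQ3 hQ4

end Generic

/-! ## §2 At `Ω_k(h)`: the section is an exact `k`-fold lift, windowed inside the region -/

section T3

variable {F : T3Family} {𝔠 : AlphaConsts F.L (suGroupModel 2).N} {γ : ℝ} {hγ : 0 < γ} {hγ1 : γ ≤ (min 𝔠.gamma0 1) ^ 2} {K : ℕ}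

/-- **★ THE ITERATED SECTION IS AN EXACT `k`-FOLD LIFT**: `iterSec k W ∈ top42Set k h W` — its `k`-fold `blockAvg ℰp`-averages equal `W` on EVERY coarse bond (`iter_iterSec`; `ℰp(1,…,1) = 1`),
a fortiori on `bondsIn k Ω_k(h)`. [cite: Balaban1985Variational, (11) p.279; Balaban1985UV3, (42) p.266] -/
theorem AlphaInputsT3AC.iterSec_mem_top42Set {k : ℕ} (hk : k ≤ K) (h : Hist (F.P K) k) (W : GaugeField (F.P K) k (Matrix.specialUnitaryGroup (Fin 2) ℂ)) :
    iterSec k W ∈ AlphaInputsT3AC.top42Set F 𝔠 γ hγ hγ1 K k h W := by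
  intro b _
  rw [iter_iterSec ℰp expMeanLogSU_E_one k (AlphaInputsT3AC.le_standing_of_le hk) W]

/-- **★ THE FINEST PLAQUETTES OF THE SECTION UNDER `Ω_k(h)` ARE BOUNDED BY THE PLAQUETTES OF `W` INSIDE `Ω_k(h)`** (`k ≤ K`, `0 ≤ ε`): the family `{z | toFine s z ∈ Ω_k(h)}` is nested
(`mem_under_Omega_iff_blockOf`), so §1 applies. [cite: Balaban1985Variational, (11) p.279; Balaban1985UV3, (39)–(40) p.266] -/
theorem AlphaInputsT3AC.dist1_iterSec_le_region {k : ℕ} (hk : k ≤ K) (h : Hist (F.P K) k) (W : GaugeField (F.P K) k (Matrix.specialUnitaryGroup (Fin 2) ℂ))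
    {ε : ℝ} (hε : 0 ≤ ε)
    (hW : ∀ Q : Plaq (F.P K) k, Q ∈ plaqsIn k (Omega 𝔠.lane.carrier.M₁
        (rcolOf (T3Scales F γ hγ (hγ1.trans (sq_min_one_le _ 𝔠.gamma0_pos)) K) 𝔠.lane.carrier) k h k) →
      GaugeGroup.dist1 (GaugeField.plaqHol W Q) ≤ ε)
    (q : Plaq (F.P K) 0) (hq : q ∈ plaqsIn 0 (Omega 𝔠.lane.carrier.M₁
        (rcolOf (T3Scales F γ hγ (hγ1.trans (sq_min_one_le _ 𝔠.gamma0_pos)) K) 𝔠.lane.carrier) k h k)) :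
    GaugeGroup.dist1 (GaugeField.plaqHol (iterSec k W) q) ≤ ε := by
  set Ω : Set (Site (F.P K) 0) := Omega 𝔠.lane.carrier.M₁ (rcolOf (T3Scales F γ hγ (hγ1.trans (sq_min_one_le _ 𝔠.gamma0_pos)) K) 𝔠.lane.carrier) k h k
    with hΩ
  obtain ⟨h1, h2, h3, h4⟩ := AlphaInputsT3AC.mem_plaqsIn_iff_corners.1 hq
  refine RegionSection.dist1_plaqHol_iterSec_le k (AlphaInputsT3AC.le_standing_of_le hk) (fun s => {z : Site (F.P K) s | toFine s z ∈ Ω})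
    (fun s hs z => AlphaInputsT3AC.mem_under_Omega_iff_blockOf (hγ := hγ) (hγ1 := hγ1) hk h hs z) W hε
    (fun Q hQ1 hQ2 hQ3 hQ4 => hW Q (AlphaInputsT3AC.mem_plaqsIn_iff_corners.2 ⟨hQ1, hQ2, hQ3, hQ4⟩)) q h1 h2 h3 h4

variable (F 𝔠 γ hγ hγ1 K) in
/-- **★★ PRINT'S (11) FOR THE FREE-BOUNDARY REGION**: for a CHARGED datum `W` at an admissible `(k, h)` (`k ≤ K`) the iterated face section `iterSec k W` lies in `top42Set k h W` (exact
`k`-fold averages) and every finest plaquette with four corners in `Ω_k(h)` is within `ε_W(k) = 2L²·avgWindowFactor·θ(K−k+1)` of `1` — the window of `ChargedT3`, with NO `L^{−2k}`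
gain (this is «V₀», the datum of Thm 1 at height `k−1`, not the regular lift (8)). [cite: Balaban1985Variational, (11)–(12) p.279–280; Balaban1985UV3, (40)+(42) p.266] -/
theorem AlphaInputsT3AC.section_of_chargedT3 {k : ℕ} (hk : k ≤ K) (h : Hist (F.P K) k) (W : GaugeField (F.P K) k (Matrix.specialUnitaryGroup (Fin 2) ℂ))
    (hW : ChargedT3 F γ 𝔠.b₀ 𝔠.p₀ (avgWindowFactor F.L) K 𝔠.lane.carrier.M₁
      (rcolOf (T3Scales F γ hγ (hγ1.trans (sq_min_one_le _ 𝔠.gamma0_pos)) K) 𝔠.lane.carrier) k h W)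
    (hθ : 0 ≤ θBal F.L γ 𝔠.b₀ 𝔠.p₀ (K - k + 1)) :
    iterSec k W ∈ AlphaInputsT3AC.top42Set F 𝔠 γ hγ hγ1 K k h W ∧
      ∀ q : Plaq (F.P K) 0, q ∈ plaqsIn 0 (Omega 𝔠.lane.carrier.M₁
          (rcolOf (T3Scales F γ hγ (hγ1.trans (sq_min_one_le _ 𝔠.gamma0_pos)) K) 𝔠.lane.carrier) k h k) →
        GaugeGroup.dist1 (GaugeField.plaqHol (iterSec k W) q) ≤
          2 * (F.L : ℝ) ^ 2 * avgWindowFactor F.L * θBal F.L γ 𝔠.b₀ 𝔠.p₀ (K - k + 1) := by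
  have hε : 0 ≤ 2 * (F.L : ℝ) ^ 2 * avgWindowFactor F.L * θBal F.L γ 𝔠.b₀ 𝔠.p₀ (K - k + 1) := by
    have hA : 0 ≤ avgWindowFactor F.L := by unfold avgWindowFactor; positivity
    positivity
  exact ⟨AlphaInputsT3AC.iterSec_mem_top42Set (hγ := hγ) (hγ1 := hγ1) hk h W,
    fun q hq => AlphaInputsT3AC.dist1_iterSec_le_region (hγ := hγ) (hγ1 := hγ1) hk h W hε (fun Q hQ => (hW.2 Q hQ).le) q hq⟩

end T3

end Summit.QuantumFields.YangMills.Theorems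

end
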